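import Literature.Topology.FourManifolds.SeifertSurfaceClosure
import Literature.Topology.FourManifolds.CircleMapRegularValues
import Literature.Topology.FourManifolds.SurfaceGenusParity
import Literature.Topology.FourManifolds.OrientedConnectedSumSphereSelf
import Literature.Topology.FourManifolds.SpinProofs
import Literature.Topology.FourManifolds.SliceGenus
import HarnessLib

/-!
# Seifert surfaces exist: assembly of the transversality construction (Juhász 2023, Prop. 4.10)

Topic `Literature/Topology/FourManifolds`; fact seat
`provefact-Literature.Topology.FourManifolds.Knot.sliceGenus_eq_zero_iff`. Everything here is
**proved**. From the sibling files: a Seifert datum `D` of the knot `K` (`SeifertLevelSurface.lean`;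
exists for every knot given the named facts `Knot.exists_circleMap_eq_angle_of_hasFraming_zero`
and `sard`, `nonempty_seifertDatum`), its closed-up level surface `Λ` and the compact surface with
boundary `Ŝ = K ∪ θ⁻¹{v}` (`SeifertSurfaceClosure.lean`) smoothly embedded in `𝕊³ ⊆ ℝ⁴` with
boundary the knot. Here:

* **the component of the knot** (`SeifertDatum.component`, an open subset of `Ŝ`): a compact
  connected `C^∞` surface with boundary containing the whole boundary circle of `Ŝ` (Juhász:
  "without closed components" — the closed components of `Ŝ` are discarded), with the
  restricted surface map and boundary homeomorphism;
* **assembly** (`SeifertDatum.hasSeifertSurfaceOfGenus_of_isOrientable`): if `Λ` is orientable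
  (proved in `SeifertSurfaceOrientation.lean`) then `K.HasSeifertSurfaceOfGenus g` for some `g`,
  the genus being read off by the parity fact
  `even_finrank_singularHomology_one_of_boundary_circle` (Hirsch 1976, Thm. 9.3.7);
* `nonempty_seifertDatum`: Seifert data exist (framing-`0` tubular neighbourhoods, the
  circle-map fact, and regular values with regular antipode from Sard's theorem).

## References

* A. Juhász, *Differential and Low-Dimensional Topology* (2023), Def. 4.8, proof of Prop. 4.10.
  [Juhasz2023]
* M. W. Hirsch, *Differential Topology* (1976), Ch. 9 §3, Thm. 3.7. [HirschDT1976]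
-/

open scoped Manifold ContDiff Topology RealInnerProductSpace
open Function Set Filter

noncomputable section

namespace Literature.Topology.FourManifolds

/-- Local notation: `𝔼 n` is the model Euclidean space `EuclideanSpace ℝ (Fin n)`. -/
local notation "𝔼 " n:arg => EuclideanSpace ℝ (Fin n)

/-- Local notation: `ℍ n` is the model half-space `EuclideanHalfSpace n`. -/
local notation "ℍ " n:arg => EuclideanHalfSpace n

/-- Local notation: `𝕊 n` is the unit sphere in `EuclideanSpace ℝ (Fin (n + 1))`. -/
local notation "𝕊 " n:arg => (Metric.sphere (0 : EuclideanSpace ℝ (Fin (n + 1))) 1)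

namespace SeifertDatum

variable {K : Knot} (D : SeifertDatum K)

/-! ### The component of the knot -/

/-- A base point of the circle. [folklore] -/
def circleBase : 𝕊 1 := ⟨EuclideanSpace.single 0 1, by simp⟩

/-- `Ŝ` is locally connected (a manifold with boundary). [folklore] -/
instance instLocallyConnectedSpaceSurface : LocallyConnectedSpace D.Surface := by
  haveI : LocallyPathConnectedSpace D.Surface :=
    ChartedSpace.locallyPathConnectedSpace (ℍ 2) D.Surface
  infer_instance

/-- **The component of the knot in `Ŝ`**, as an open subset of `Ŝ` (components of a locally
connected space are open). Juhász (2023), Def. 4.8 ("without closed components") and proof of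
Prop. 4.10. [cite: Juhasz2023, Def. 4.8 and proof of Prop. 4.10] -/
def component : TopologicalSpace.Opens D.Surface :=
  ⟨connectedComponent (D.knotPt circleBase), isOpen_connectedComponent⟩

/-- Membership in the component. [folklore] -/
theorem mem_component_iff (p : D.Surface) :
    p ∈ D.component ↔ p ∈ connectedComponent (D.knotPt circleBase) := Iff.rfl

/-- The component is compact (components are closed in the compact `Ŝ`). [folklore] -/
instance instCompactSpaceComponent : CompactSpace D.component :=
  isCompact_iff_compactSpace.mp isClosed_connectedComponent.isCompact

/-- The component is connected. [folklore] -/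
instance instConnectedSpaceComponent : ConnectedSpace D.component :=
  isConnected_iff_connectedSpace.mp isConnected_connectedComponent

/-- **The whole knot lies in the component** (the boundary circle is connected and meets it).
[folklore] -/
theorem knotPt_mem_component (x : 𝕊 1) : D.knotPt x ∈ D.component := by
  haveI : PreconnectedSpace (𝕊 1) := Subtype.preconnectedSpace
    (isPreconnected_sphere (one_lt_rank_euclideanSpace one_lt_two) _ _)
  have hsub : range D.knotPt ⊆ connectedComponent (D.knotPt circleBase) :=
    (isPreconnected_range D.continuous_knotPt).subset_connectedComponent (mem_range_self _)
  exact hsub (mem_range_self x)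

/-- **The boundary of the component is the boundary of `Ŝ`** (an open subset has the boundary
points of the ambient manifold, Mathlib `ModelWithCorners.isBoundaryPoint_iff_isBoundaryPoint_val`),
i.e. the knot. [folklore] -/
theorem isBoundaryPoint_component_iff (p : D.component) :
    (𝓡∂ 2).IsBoundaryPoint p ↔ D.surfToSphere p.1 ∈ range ⇑K := by
  rw [ModelWithCorners.isBoundaryPoint_iff_isBoundaryPoint_val]
  exact D.isBoundaryPoint_iff_mem_range p.1

/-- The knot point `K x` as a point of the component. [folklore] -/
def knotPt' (x : 𝕊 1) : D.component := ⟨D.knotPt x, D.knotPt_mem_component x⟩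

/-- `knotPt'` is continuous. [folklore] -/
theorem continuous_knotPt' : Continuous D.knotPt' := D.continuous_knotPt.subtype_mk _

/-- Knot points are boundary points of the component. [folklore] -/
theorem knotPt'_mem_boundary (x : 𝕊 1) : D.knotPt' x ∈ (𝓡∂ 2).boundary D.component :=
  (D.isBoundaryPoint_component_iff _).mpr (mem_range_self x)

/-- **The boundary of the component is homeomorphic to the circle**, by `K⁻¹`.
[cite: Juhasz2023, proof of Prop. 4.10] -/
def componentBoundaryHomeomorph : ↥((𝓡∂ 2).boundary D.component) ≃ₜ (𝕊 1) where
  toFun b := K.isSmoothEmbedding.isEmbedding.toHomeomorph.symm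
    ⟨D.surfToSphere b.1.1, (D.isBoundaryPoint_component_iff b.1).mp b.2⟩
  invFun x := ⟨D.knotPt' x, D.knotPt'_mem_boundary x⟩
  left_inv b := by
    apply Subtype.ext; apply Subtype.ext
    apply D.surfToSphere_injective
    have h' := congrArg Subtype.val (K.isSmoothEmbedding.isEmbedding.toHomeomorph.apply_symm_apply
      ⟨D.surfToSphere b.1.1, (D.isBoundaryPoint_component_iff b.1).mp b.2⟩)
    exact h'
  right_inv x := by
    show K.isSmoothEmbedding.isEmbedding.toHomeomorph.symm ⟨K x, _⟩ = x
    have : (⟨K x, (D.isBoundaryPoint_component_iff (D.knotPt' x)).mp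
        (D.knotPt'_mem_boundary x)⟩ : ↥(range ⇑K)) =
        K.isSmoothEmbedding.isEmbedding.toHomeomorph x := rfl
    rw [this, Homeomorph.symm_apply_apply]
  continuous_toFun :=
    K.isSmoothEmbedding.isEmbedding.toHomeomorph.symm.continuous.comp
      (((D.continuous_surfToSphere.comp continuous_subtype_val).comp
        continuous_subtype_val).subtype_mk _)
  continuous_invFun := D.continuous_knotPt'.subtype_mk _

/-- On the boundary of the component, the inclusion is `K ∘ e`. [folklore] -/
theorem surfToSphere_eq_apply_componentBoundaryHomeomorph (b : ↥((𝓡∂ 2).boundary D.component)) :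
    D.surfToSphere b.1.1 = K (D.componentBoundaryHomeomorph b) :=
  (congrArg Subtype.val (K.isSmoothEmbedding.isEmbedding.toHomeomorph.apply_symm_apply
    ⟨D.surfToSphere b.1.1, (D.isBoundaryPoint_component_iff b.1).mp b.2⟩)).symm

/-! ### The surface map on the component -/

/-- **The surface map of the component**, `Ŝ₀ ⊆ Ŝ ⊆ 𝕊³ ⊆ ℝ⁴`. [folklore] -/
def componentMap (p : D.component) : 𝔼 4 := D.surfaceMap p.1

/-- `componentMap` is `surfaceMap` restricted (definitional). [folklore] -/
theorem componentMap_eq : D.componentMap = D.surfaceMap ∘ Subtype.val := rfl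

/-- The surface map of the component is smooth. [folklore] -/
theorem contMDiff_componentMap : ContMDiff (𝓡∂ 2) 𝓘(ℝ, 𝔼 4) ∞ D.componentMap :=
  D.contMDiff_surfaceMap.comp contMDiff_subtype_val

/-- The surface map of the component is injective. [folklore] -/
theorem componentMap_injective : Injective D.componentMap :=
  D.surfaceMap_injective.comp Subtype.val_injective

/-- `‖componentMap p‖ = 1`. [folklore] -/
theorem norm_componentMap (p : D.component) : ‖D.componentMap p‖ = 1 := D.norm_surfaceMap p.1

/-- **The surface map of the component is an immersion**, boundary points included (the
inclusion of an open submanifold has identity differential, `mfderiv_subtype_val`). [folklore] -/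
theorem injective_mfderiv_componentMap (p : D.component) :
    Injective (mfderiv (𝓡∂ 2) 𝓘(ℝ, 𝔼 4) D.componentMap p) := by
  have hd1 : MDifferentiableAt (𝓡∂ 2) (𝓡∂ 2) (Subtype.val : D.component → D.Surface) p :=
    mdifferentiableAt_subtype_val p
  have hd2 : MDifferentiableAt (𝓡∂ 2) 𝓘(ℝ, 𝔼 4) D.surfaceMap p.1 :=
    (D.contMDiff_surfaceMap p.1).mdifferentiableAt (by simp)
  rw [componentMap_eq, mfderiv_comp p hd2 hd1, mfderiv_subtype_val]
  intro a b hab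
  exact D.injective_mfderiv_surfaceMap p.1 hab

/-- On the boundary of the component, `F = K ∘ e`. [folklore] -/
theorem componentMap_boundary (b : ↥((𝓡∂ 2).boundary D.component)) :
    D.componentMap b.1 = ((K (D.componentBoundaryHomeomorph b) : 𝕊 3) : 𝔼 4) := by
  show ((D.surfToSphere b.1.1 : 𝕊 3) : 𝔼 4) = _
  rw [D.surfToSphere_eq_apply_componentBoundaryHomeomorph b]

/-! ### Assembly: a Seifert surface of some genus, given orientability of `Λ` -/

/-- **Orientability descends from `Λ` to the component** (codimension-`0` immersion `Ŝ ↪ Λ`,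
`IsOrientable.of_isImmersion`; open subset, `IsOrientable.opens`). [folklore] -/
theorem isOrientable_component (hor : IsOrientable (𝓡 2) D.Sheet) :
    IsOrientable (𝓡∂ 2) D.component :=
  (IsOrientable.of_isImmersion D.isImmersion_surfIncl hor).opens D.component

/-- **A Seifert datum with orientable `Λ` yields a Seifert surface of some genus** in the sense
of `Knot.HasSeifertSurfaceOfGenus` (`SliceGenus.lean`): the component of the knot in
`Ŝ = K ∪ θ⁻¹{v}` with the inclusion into `𝕊³ ⊆ ℝ⁴`, a compact connected orientable `C^∞`
surface with boundary the knot (Juhász 2023, proof of Prop. 4.10); its first Betti number is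
even by the parity fact (Hirsch 1976, Thm. 9.3.7), which gives the genus.
[cite: Juhasz2023, proof of Prop. 4.10] [cite: HirschDT1976, Ch. 9 §3, Thm. 3.7] -/
theorem hasSeifertSurfaceOfGenus_of_isOrientable (hor : IsOrientable (𝓡 2) D.Sheet)
    (hpar : even_finrank_singularHomology_one_of_boundary_circle) :
    ∃ g, K.HasSeifertSurfaceOfGenus g := by
  have hO := D.isOrientable_component hor
  obtain ⟨g, hg⟩ := exists_finrank_singularHomology_one_eq_two_mul hpar D.component
    D.componentBoundaryHomeomorph hO
  refine ⟨g, D.component, inferInstance, inferInstance, inferInstance, inferInstance,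
    inferInstance, inferInstance, inferInstance, D.componentMap, D.componentBoundaryHomeomorph,
    ⟨hO, D.contMDiff_componentMap, D.componentMap_injective, D.injective_mfderiv_componentMap,
      fun b => D.componentMap_boundary b, hg⟩, D.norm_componentMap⟩

end SeifertDatum

/-! ### Seifert data exist -/

/-- **Every knot has a Seifert datum**, granted the circle-map fact and Sard's theorem: a tubular
neighbourhood of framing `0` (`Knot.exists_tubularNbhd_hasFraming_holds`), the circle-valued map
which is the fibre angle on its punctured unit tube (the named fact
`Knot.exists_circleMap_eq_angle_of_hasFraming_zero`), and a regular value `v = circlePt t` whose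
antipode `circlePt (t + 1/2) = -v` is regular too (`exists_circlePt_isRegularValue_and_antipode`,
from `sard`). [cite: Juhasz2023, proof of Prop. 4.10] -/
theorem nonempty_seifertDatum (hθ : Knot.exists_circleMap_eq_angle_of_hasFraming_zero)
    (hS : Literature.Analysis.Calculus.sard) (K : Knot) : Nonempty (SeifertDatum K) := by
  obtain ⟨ν, θ, -, hθs, hang⟩ := Knot.exists_tubularNbhd_circleMap hθ K
  obtain ⟨t, h1, h2⟩ := exists_circlePt_isRegularValue_and_antipode hS hθs
  refine ⟨⟨ν, θ, circlePt t, hθs, hang, fun p hp => h1 p (Subtype.ext hp),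
    fun p hp => h2 p (Subtype.ext ?_)⟩⟩
  rw [hp, coe_circlePt_add_half]

/-- **Seifert's theorem from the leaves, given orientability of the level surfaces**: if for
every Seifert datum the closed-up level surface `Λ` is orientable (proved in
`SeifertSurfaceOrientation.lean`), then every knot bounds a Seifert surface of some genus,
granted the circle-map fact, Sard's theorem and the genus parity fact.
[cite: Juhasz2023, Prop. 4.10] -/
theorem Knot.exists_hasSeifertSurfaceOfGenus_of_isOrientable
    (hor : ∀ (K : Knot) (D : SeifertDatum K), IsOrientable (𝓡 2) D.Sheet)
    (hθ : Knot.exists_circleMap_eq_angle_of_hasFraming_zero)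
    (hS : Literature.Analysis.Calculus.sard)
    (hpar : even_finrank_singularHomology_one_of_boundary_circle) :
    Knot.exists_hasSeifertSurfaceOfGenus := by
  intro K
  obtain ⟨D⟩ := nonempty_seifertDatum hθ hS K
  exact D.hasSeifertSurfaceOfGenus_of_isOrientable (hor K D) hpar

end Literature.Topology.FourManifolds
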